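import Summits.CriticalPhenomena.CardyFormulaZ2.Theorems.CardyComplexConeSLESixFamiliesGiveCardyDefs
import Literature.Probability.RandomPlanarGeometry.LocalMartingaleProofs
import Mathlib.MeasureTheory.Measure.Portmanteau
import HarnessLib

/-!
# Stub `touchLimsup` of line `collar-touch-sandwich`

Crux `SLESixFamiliesGiveCardy` (stmt-CriticalPhenomena-9654), route `CardyComplexCone`.

Closed-set portmanteau along the mesh filter `𝓝[>] 0`, the pure measure theory step of the
touch-free Cardy readout: `theorem stub_touchLimsup : TouchLimsup`.

If the random curve classes `X δ` (under bond percolation `P = P_{1/2}` on `ℤ²`) converge in law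
(`TendstoLaw`: bounded continuous test functions, along `𝓝[>] 0`) to a `W`-a.e.-measurable `Γ`
(`W = Process.preWienerMeasure`, a probability measure by `isProbabilityMeasure_preWienerMeasure'`)
and are eventually a.e.-measurable, then for every closed `K ⊆ ℂ`, every family of events `E δ`
eventually contained in `{ω | trace (X δ ω) ∩ K ≠ ∅}` and every `ε > 0`, eventually
`P (E δ) ≤ Law(Γ)(hitsBefore K ∅) + ε`.

Proof (`eventually_measureReal_le_of_tendstoLaw`, for arbitrary probability spaces): pad the
laws of `X δ` at the (eventually absent) non-measurable meshes by the limit law to get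
`ProbabilityMeasure`s `μ δ → Law(Γ)` weakly
(`ProbabilityMeasure.tendsto_iff_forall_integral_tendsto`, `integral_map`); for a closed event `F`
Mathlib's portmanteau implication `ProbabilityMeasure.limsup_measure_closed_le_of_tendsto`
bounds `limsup μ δ F ≤ Law(Γ) F`; `Filter.eventually_lt_of_limsup_lt` in `ℝ≥0∞` and
monotonicity of outer measure (`measureReal_mono`, `Measure.le_map_apply`) finish.  The target
event `hitsBefore K ∅ = {c | c.range ∩ K ≠ ∅}` is closed
(`CurveClass.isClosed_hitsBefore_empty_right`).  No named fact is used.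
-/

noncomputable section

open Set Filter Topology Metric MeasureTheory
open scoped NNReal ENNReal
open Literature.Probability Literature.Probability.RandomPlanarGeometry
  Literature.Probability.LatticeModels Literature.Probability.Percolation

namespace Summit.CriticalPhenomena.CardyFormulaZ2.Cruxes.SLESixFamiliesGiveCardy.CollarTouchSandwich

/-- Membership in the degenerate crossing event `hitsBefore K ∅`: the trace meets `K`. -/
theorem mem_hitsBefore_empty_right_iff (K : Set ℂ) (c : CurveClass ℂ) :
    c ∈ CurveClass.hitsBefore K (∅ : Set ℂ) ↔ (c.range ∩ K).Nonempty := by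
  rw [CurveClass.hitsBefore_empty_right, mem_compl_iff, CurveClass.mem_rangeSubset,
    subset_compl_iff_disjoint_right, not_disjoint_iff_nonempty_inter]

/-- **Weak convergence with junk padding.**  If `X δ` converges in law to `Γ` (bounded
continuous test functions along `𝓝[>] 0`) and is eventually a.e.-measurable, then any
probability laws `μ δ` agreeing with `Law(X δ)` wherever `X δ` is a.e.-measurable converge to
`ν = Law(Γ)` in `ProbabilityMeasure (CurveClass ℂ)`. -/
theorem tendsto_paddedLaw {Ω Ω' : Type*} [MeasurableSpace Ω] [MeasurableSpace Ω']
    {P : Measure Ω} {W : Measure Ω'} {X : ℝ → Ω → CurveClass ℂ} {Γ : Ω' → CurveClass ℂ}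
    (hΓ : AEMeasurable Γ W) (hX : ∀ᶠ δ : ℝ in 𝓝[>] 0, AEMeasurable (X δ) P)
    (hlaw : TendstoLaw X (fun _ => P) Γ W) (μ : ℝ → ProbabilityMeasure (CurveClass ℂ))
    (hμ : ∀ δ, AEMeasurable (X δ) P →
      ((μ δ : ProbabilityMeasure (CurveClass ℂ)) : Measure (CurveClass ℂ)) = P.map (X δ))
    (ν : ProbabilityMeasure (CurveClass ℂ)) (hν : (ν : Measure (CurveClass ℂ)) = W.map Γ) :
    Tendsto μ (𝓝[>] (0 : ℝ)) (𝓝 ν) := by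
  rw [ProbabilityMeasure.tendsto_iff_forall_integral_tendsto]
  intro f
  rw [hν, integral_map hΓ f.continuous.aestronglyMeasurable]
  refine (hlaw f).congr' ?_
  filter_upwards [hX] with δ hδ
  rw [hμ δ hδ, integral_map hδ f.continuous.aestronglyMeasurable]

/-- **Closed-set portmanteau along the mesh filter, with sub-events.**  For probability measures
`P`, `W`, random curve classes `X δ` converging in law to a `W`-a.e.-measurable `Γ` and eventually
`P`-a.e.-measurable, a closed event `F` and events `E δ` eventually contained in `X δ ⁻¹' F`:
for every `ε > 0`, eventually `P (E δ) ≤ Law(Γ) F + ε` (real-valued measures). -/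
theorem eventually_measureReal_le_of_tendstoLaw {Ω Ω' : Type*} [MeasurableSpace Ω]
    [MeasurableSpace Ω'] {P : Measure Ω} [IsProbabilityMeasure P] {W : Measure Ω'}
    [IsProbabilityMeasure W] {X : ℝ → Ω → CurveClass ℂ} {Γ : Ω' → CurveClass ℂ}
    (hΓ : AEMeasurable Γ W) (hXm : ∀ᶠ δ : ℝ in 𝓝[>] 0, AEMeasurable (X δ) P)
    (hlaw : TendstoLaw X (fun _ => P) Γ W) {F : Set (CurveClass ℂ)} (hFc : IsClosed F)
    {E : ℝ → Set Ω} (hE : ∀ᶠ δ : ℝ in 𝓝[>] 0, E δ ⊆ X δ ⁻¹' F) {ε : ℝ} (hε : 0 < ε) :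
    ∀ᶠ δ : ℝ in 𝓝[>] 0, P.real (E δ) ≤ (W.map Γ).real F + ε := by
  classical
  -- the limit law `ν` and the padded laws `μ δ` of `X δ`
  let ν : ProbabilityMeasure (CurveClass ℂ) := ⟨W.map Γ, Measure.isProbabilityMeasure_map hΓ⟩
  let μ : ℝ → ProbabilityMeasure (CurveClass ℂ) := fun δ =>
    if h : AEMeasurable (X δ) P then ⟨P.map (X δ), Measure.isProbabilityMeasure_map h⟩ else ν
  have hμ : ∀ δ, AEMeasurable (X δ) P →
      ((μ δ : ProbabilityMeasure (CurveClass ℂ)) : Measure (CurveClass ℂ)) = P.map (X δ) := by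
    intro δ h
    simp only [μ, dif_pos h, ProbabilityMeasure.coe_mk]
  have hν : (ν : Measure (CurveClass ℂ)) = W.map Γ := rfl
  have hT : Tendsto μ (𝓝[>] (0 : ℝ)) (𝓝 ν) := tendsto_paddedLaw hΓ hXm hlaw μ hμ ν hν
  -- portmanteau for the closed event `F`, then `limsup < value + ε` eventually
  have hlimsup : limsup (fun δ => (μ δ : Measure (CurveClass ℂ)) F) (𝓝[>] (0 : ℝ)) ≤
      (W.map Γ) F :=
    (ProbabilityMeasure.limsup_measure_closed_le_of_tendsto hT hFc).trans_eq (by rw [hν])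
  have hfin : (W.map Γ) F ≠ ∞ := measure_ne_top _ _
  have hev : ∀ᶠ δ in 𝓝[>] (0 : ℝ),
      (μ δ : Measure (CurveClass ℂ)) F < (W.map Γ) F + ENNReal.ofReal ε :=
    eventually_lt_of_limsup_lt
      (hlimsup.trans_lt (ENNReal.lt_add_right hfin (ENNReal.ofReal_pos.2 hε).ne'))
  -- monotonicity of outer measure along the three eventualities
  filter_upwards [hev, hXm, hE] with δ hδ hXδ hEδ
  calc P.real (E δ) ≤ P.real (X δ ⁻¹' F) := measureReal_mono hEδ
    _ = (P (X δ ⁻¹' F)).toReal := rfl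
    _ ≤ ((P.map (X δ)) F).toReal :=
        ENNReal.toReal_mono (measure_ne_top _ _) (Measure.le_map_apply hXδ F)
    _ ≤ ((W.map Γ) F + ENNReal.ofReal ε).toReal := by
        refine ENNReal.toReal_mono (by finiteness) ?_
        rw [← hμ δ hXδ]
        exact hδ.le
    _ = (W.map Γ).real F + ε := by
        rw [ENNReal.toReal_add hfin ENNReal.ofReal_ne_top, ENNReal.toReal_ofReal hε.le,
          measureReal_def]

/-- **STUB C** of line `collar-touch-sandwich`: closed-set portmanteau along the mesh filter for
the closed range event `hitsBefore K ∅` ("the trace meets `K`") under bond percolation at `1/2`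
on `ℤ²` and the pre-Wiener probability measure, with junk padding at the eventually absent
non-measurable meshes and monotonicity of outer measure for the sub-events `E δ`. -/
theorem stub_touchLimsup : TouchLimsup := by
  intro X Γ hΓ hXm hlaw K hK E hE ε hε
  haveI : IsProbabilityMeasure Process.preWienerMeasure := isProbabilityMeasure_preWienerMeasure'
  refine eventually_measureReal_le_of_tendstoLaw hΓ hXm hlaw
    (CurveClass.isClosed_hitsBefore_empty_right hK) ?_ hε
  filter_upwards [hE] with δ hδ
  exact fun ω hω => (mem_hitsBefore_empty_right_iff K _).2 (hδ hω)

end Summit.CriticalPhenomena.CardyFormulaZ2.Cruxes.SLESixFamiliesGiveCardy.CollarTouchSandwich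

end
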